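import Summits.QuantumFields.Balaban3D.Proofs.HistCount

/-!
# Route `UnitScaleTilt` — crux K2-L `HistoryTailL` (stmt-QuantumFields-19936), STUB 4a `stub_historyMassBound`: THE ENTROPY OF THE REGION HISTORIES —
# `Σ_{h} Π_i t_i^{#P_i(h)} = Π_i (1 + t_i)^{|Plaq_i|} ≤ exp(Σ_i t_i·|Plaq_i|)` (support file; the resummation of the history sum (41) p.266 against the per-plaquette
# small factors `t_i = e^{−σ(i,j)}` of the dilute-family bookkeeping)

Fleet lead `ym-ust-18916-p1` (gen 3), 2026-08-27.

* `sum_pow_card_eq` — `Σ_{s : Finset α} t^{#s} = (1 + t)^{|α|}`;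
* **`sum_hist_prod_pow_card`** — over `Hist P j = Π_{i<j} Finset (Plaq P i)`: `Σ_h Π_i t_i^{#(h i)} = Π_i (1 + t_i)^{|Plaq P i|}`;
* `sum_hist_prod_pow_card_le_exp` — `≤ exp(Σ_i t_i·|Plaq P i|)` for `t ≥ 0`.

References: T. Bałaban, CMP 102 (1985) 255–275 [Balaban1985UV3] ((41) p.266).
-/

noncomputable section

open scoped BigOperators

namespace Summit.QuantumFields.YangMills.Theorems.HistoryTailHistSum

open Literature.MathematicalPhysics.QuantumFieldTheory.Balaban1983to89
open Summit.QuantumFields.Balaban3D.Carriers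
open Classical

/-- `Σ_{s : Finset α} t^{#s} = (1 + t)^{|α|}` (binomial theorem over subsets). [folklore] -/
theorem sum_pow_card_eq {α : Type*} [Fintype α] (t : ℝ) : ∑ s : Finset α, t ^ s.card = (1 + t) ^ Fintype.card α := by
  have h := Fintype.sum_pow_mul_eq_add_pow α t 1
  simp only [one_pow, mul_one] at h
  rw [h, add_comm]

/-- **THE HISTORY SUM FACTORISES**: `Σ_{h : Hist P j} Π_i t_i^{#(h i)} = Π_i (1 + t_i)^{|Plaq P i|}`. [cite: Balaban1985UV3, (41) p.266] -/
theorem sum_hist_prod_pow_card {P : Params} (j : ℕ) (t : Fin j → ℝ) :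
    ∑ h : Hist P j, ∏ i : Fin j, t i ^ (h i).card = ∏ i : Fin j, (1 + t i) ^ Fintype.card (Plaq P i) := by
  have h1 : ∏ i : Fin j, (1 + t i) ^ Fintype.card (Plaq P i) =
      ∏ i : Fin j, ∑ s ∈ (Finset.univ : Finset (Finset (Plaq P i))), t i ^ s.card :=
    Finset.prod_congr rfl fun i _ => (sum_pow_card_eq (t i)).symm
  rw [h1, Finset.prod_univ_sum]
  simp only [Fintype.piFinset_univ]
  rfl

/-- **AND IS AT MOST `exp(Σ_i t_i·|Plaq P i|)`** for `t ≥ 0`. [cite: Balaban1985UV3, (41) p.266] -/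
theorem sum_hist_prod_pow_card_le_exp {P : Params} (j : ℕ) (t : Fin j → ℝ) (ht : ∀ i, 0 ≤ t i) :
    ∑ h : Hist P j, ∏ i : Fin j, t i ^ (h i).card ≤ Real.exp (∑ i : Fin j, t i * Fintype.card (Plaq P i)) := by
  rw [sum_hist_prod_pow_card, Real.exp_sum]
  refine Finset.prod_le_prod (fun i _ => pow_nonneg (by linarith [ht i]) _) fun i _ => ?_
  calc (1 + t i) ^ Fintype.card (Plaq P i) ≤ Real.exp (t i) ^ Fintype.card (Plaq P i) :=
        pow_le_pow_left₀ (by linarith [ht i]) (by linarith [Real.add_one_le_exp (t i)]) _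
    _ = Real.exp (t i * Fintype.card (Plaq P i)) := by rw [← Real.exp_nat_mul]; ring_nf

end Summit.QuantumFields.YangMills.Theorems.HistoryTailHistSum

end
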